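import Mathlib
import Literature.AlgebraicGeometry.Resolution.CobordantBlowupFiltration
import Summits.ResolutionOfSingularities.ResolutionOfSingularities.Theorems.WeightedInvariantDatumToEmbeddedDegreeVeronese
import HarnessLib

/-!
# Degree-zero parts of a homogeneous filtration are eventually generated in degree one

Topic: `Summits/ResolutionOfSingularities/ResolutionOfSingularities/Theorems`. Pure commutative
algebra for stub `stub_qs_degree` of the line `Sketch` of the crux
`Theses.WeightedInvariant.DatumToEmbedded` (statement `stmt-ResolutionOfSingularities-0572`) of the
summit `Summit.ResolutionOfSingularities.ResolutionOfSingularities`; the stub itself is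
`Theorems/WeightedInvariantDatumToEmbeddedDegree.lean`, the monomial combinatorics is
`Theorems/WeightedInvariantDatumToEmbeddedDegreeVeronese.lean`.

Setting (Włodarczyk, arXiv:2203.03090, §2.3.3, the quotient of a cobordant blow-up by the torus):
`A` a finitely generated commutative `C`-algebra graded by an abelian group `M` through additive
subgroups `A_χ` (a `𝔾ₘʲ`-stable affine chart `Spec A`, `C` the scalars, in degree `0`), and a
descending multiplicative filtration `F = (Jₙ)` of HOMOGENEOUS ideals whose extended Rees algebra
`A[t⁻¹, Jₙ tⁿ]` (`IdealFiltration.extendedRees`, the sections of the cobordant blow-up over the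
chart) is of finite type over `A`.

* `coeff_mem_span_of_mem_adjoin`, `exists_rees_generators` — **monomial generators of the
  pieces**: finitely many homogeneous `yᵢ ∈ J_{nᵢ}` (homogeneous components of the coefficients
  of generators of `A[t⁻¹, Jₙ tⁿ]`) with `J_N ⊆ (y^α : ∑ αᵢ nᵢ ≥ N)` for every `N` (read off the
  `t^N`-coefficient of a combination of monomials `t^{-c} ∏ (yᵢ t^{nᵢ})^{αᵢ}`);
* `veronese_degreeZero` — **the degree-`0` parts `Tₙ = Jₙ ∩ A₀` are eventually generated in
  degree one**: there is `d > 0` such that for every multiple `d'` of `d` and every `l`,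
  `T_{d'(l+1)}` lies in the additive closure of the products `T_{d'} · T_{d'l}` (degree-`0`
  monomial generators of `…DegreeVeronese.exists_degreeZero_generators`, a weighted polynomial
  ring mapping onto them, and its eventually standard tails `exists_tail_veronese`).

All proofs are glue on Mathlib and the tree; no definitions, no named facts.
-/

set_option linter.dupNamespace false -- mandated namespace `…Theorems.DatumToEmbedded.<Topic>`

namespace Summit.ResolutionOfSingularities.ResolutionOfSingularities.Theorems.DatumToEmbedded.Degree

open DirectSum LaurentPolynomial AddMonoidAlgebra Literature.AlgebraicGeometry.Resolution
open scoped LaurentPolynomial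

/-! ## Monomial generators of the pieces of a filtration with finitely generated Rees algebra -/

section Rees

variable {A : Type} [CommRing A]

/-- **Coefficients of the algebra generated by `t⁻¹` and monomials `yᵢ t^{nᵢ}`**: the
`t^N`-coefficient (`N ≥ 0`) of any element of `A[t⁻¹, yᵢ t^{nᵢ}] ⊆ A[t, t⁻¹]` lies in the ideal
`(y^α : ∑ αᵢ nᵢ ≥ N)` — a monomial `t^{-c} ∏ (yᵢ t^{nᵢ})^{αᵢ}` contributes `y^α` in degree
`∑ αᵢ nᵢ - c`. [folklore] -/
theorem coeff_mem_span_of_mem_adjoin {ι : Type} [Fintype ι] (y : ι → A) (n : ι → ℕ)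
    {q : A[T;T⁻¹]}
    (hq : q ∈ Algebra.adjoin A (Set.range fun o : Option ι =>
      Option.elim o (T (-1)) fun i => C (y i) * T (n i : ℤ)))
    (N : ℕ) :
    q.coeff (N : ℤ) ∈ Ideal.span {m | ∃ α : ι → ℕ, N ≤ ∑ i, α i * n i ∧ m = ∏ i, y i ^ α i} := by
  classical
  have hq' : q ∈ Subalgebra.toSubmodule (Algebra.adjoin A (Set.range fun o : Option ι =>
      Option.elim o (T (-1)) fun i => C (y i) * T (n i : ℤ))) := hq
  clear hq
  rw [Algebra.adjoin_eq_span] at hq'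
  induction hq' using Submodule.span_induction generalizing N with
  | mem m hm =>
    obtain ⟨β, rfl⟩ := Submonoid.mem_closure_range_iff_of_fintype.1 hm
    have h1 : ∏ o : Option ι, (Option.elim o (T (-1)) fun i => C (y i) * T (n i : ℤ)) ^ β o =
        AddMonoidAlgebra.single (β none • (-1 : ℤ) + ∑ i, β (some i) • (n i : ℤ))
          (∏ i, y i ^ β (some i)) := by
      rw [Fintype.prod_option]
      simp only [Option.elim]
      simp_rw [← single_eq_C_mul_T, show (T (-1) : A[T;T⁻¹]) = AddMonoidAlgebra.single (-1 : ℤ) 1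
        from rfl, single_pow, one_pow, prod_single, single_mul_single, one_mul]
    rw [h1, coeff_single, Finsupp.single_apply]
    split_ifs with h
    · refine Ideal.subset_span ⟨fun i => β (some i), ?_, rfl⟩
      have h2 : ((N : ℕ) : ℤ) ≤ ∑ i, ((β (some i) * n i : ℕ) : ℤ) := by
        rw [← h]
        simp only [nsmul_eq_mul, Nat.cast_mul, mul_neg, mul_one]
        linarith [Int.natCast_nonneg (β none)]
      exact_mod_cast h2
    · exact Ideal.zero_mem _
  | zero => exact Ideal.zero_mem _
  | add p q _ _ hp hq =>
    rw [coeff_add, Finsupp.add_apply]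
    exact Ideal.add_mem _ (hp N) (hq N)
  | smul a p _ hp =>
    rw [coeff_smul, Finsupp.smul_apply, smul_eq_mul]
    exact Ideal.mul_mem_left _ _ (hp N)

variable {M : Type} [DecidableEq M] [AddCommGroup M] (𝒜 : M → AddSubgroup A) [GradedRing 𝒜]
  (F : IdealFiltration A) (hF : ∀ n, (F.ideal n).IsHomogeneous 𝒜)

include hF in
/-- **Homogeneous monomial generators of the pieces.** If the pieces `Jₙ` of the filtration are
homogeneous and the extended Rees algebra `A[t⁻¹, Jₙ tⁿ]` is of finite type over `A`, there are
finitely many homogeneous `yᵢ ∈ J_{nᵢ} ∩ A_{δᵢ}` with `J_N ⊆ (y^α : ∑ αᵢ nᵢ ≥ N)` for all `N`: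
the homogeneous components of the coefficients of a finite generating set (still in the pieces, by
homogeneity, and still generating, together with `t⁻¹`). [folklore] -/
theorem exists_rees_generators (hR : Algebra.FiniteType A F.extendedRees) :
    ∃ (ι : Type) (_ : Fintype ι) (y : ι → A) (n : ι → ℕ) (δ : ι → M),
      (∀ i, y i ∈ F.ideal (n i)) ∧ (∀ i, y i ∈ 𝒜 (δ i)) ∧
      ∀ (N : ℕ) (x : A), x ∈ F.ideal N →
        x ∈ Ideal.span {m | ∃ α : ι → ℕ, N ≤ ∑ i, α i * n i ∧ m = ∏ i, y i ^ α i} := by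
  classical
  obtain ⟨s, hs⟩ := hR.out
  -- the `t`-exponents and the degrees occurring in the generators
  set SN : Finset ℤ := s.biUnion fun p => ((p : F.extendedRees) : A[T;T⁻¹]).coeff.support
    with hSN
  set SM : Finset M := s.biUnion fun p => SN.biUnion fun N =>
    (decompose 𝒜 (((p : F.extendedRees) : A[T;T⁻¹]).coeff N)).support with hSM
  set y : ↥s × ↥SN × ↥SM → A := fun t =>
    (decompose 𝒜 (((t.1 : F.extendedRees) : A[T;T⁻¹]).coeff (t.2.1 : ℤ)) (t.2.2 : M) : A) with hy
  set n : ↥s × ↥SN × ↥SM → ℕ := fun t => (t.2.1 : ℤ).toNat with hn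
  refine ⟨↥s × ↥SN × ↥SM, inferInstance, y, n, fun t => (t.2.2 : M), ?_,
    fun t => SetLike.coe_mem _, ?_⟩
  · rintro ⟨p, N, χ⟩
    rcases le_or_gt (N : ℤ) 0 with hN | hN
    · have h0 : n (p, N, χ) = 0 := Int.toNat_eq_zero.mpr hN
      rw [h0, F.ideal_zero]
      exact Submodule.mem_top
    · have hc : ((p : F.extendedRees) : A[T;T⁻¹]).coeff (N : ℤ) ∈ F.ideal (n (p, N, χ)) := by
        have h := (F.mem_extendedRees_iff.mp (p : F.extendedRees).2) (N : ℤ).toNat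
        rwa [Int.toNat_of_nonneg hN.le] at h
      exact hF _ _ hc
  · intro N x hx
    -- every generator lies in the subalgebra generated by `t⁻¹` and the `y t^{n}`
    have hgen : ∀ p (hp : p ∈ s), ((p : F.extendedRees) : A[T;T⁻¹]) ∈
        Algebra.adjoin A (Set.range fun o : Option (↥s × ↥SN × ↥SM) =>
          Option.elim o (T (-1)) fun t => C (y t) * T (n t : ℤ)) := by
      intro p hp
      rw [← sum_coeff_single ((p : F.extendedRees) : A[T;T⁻¹]), Finsupp.sum]
      refine Subalgebra.sum_mem _ fun N hN => ?_
      have hNmem : N ∈ SN := Finset.mem_biUnion.mpr ⟨p, hp, hN⟩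
      rw [← sum_support_decompose 𝒜 (((p : F.extendedRees) : A[T;T⁻¹]).coeff N),
        show AddMonoidAlgebra.single N (∑ χ ∈ (decompose 𝒜 (((p : F.extendedRees) :
            A[T;T⁻¹]).coeff N)).support, (decompose 𝒜 (((p : F.extendedRees) : A[T;T⁻¹]).coeff
            N) χ : A)) = ∑ χ ∈ (decompose 𝒜 (((p : F.extendedRees) : A[T;T⁻¹]).coeff
            N)).support, AddMonoidAlgebra.single N ((decompose 𝒜 (((p : F.extendedRees) :
            A[T;T⁻¹]).coeff N) χ : A)) from map_sum (singleAddHom N) _ _]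
      refine Subalgebra.sum_mem _ fun χ hχ => ?_
      have hχmem : χ ∈ SM :=
        Finset.mem_biUnion.mpr ⟨p, hp, Finset.mem_biUnion.mpr ⟨N, hNmem, hχ⟩⟩
      set t : ↥s × ↥SN × ↥SM := (⟨p, hp⟩, ⟨N, hNmem⟩, ⟨χ, hχmem⟩) with ht
      change AddMonoidAlgebra.single N (y t) ∈ _
      have htmem : C (y t) * T (n t : ℤ) ∈ Algebra.adjoin A (Set.range fun o : Option
          (↥s × ↥SN × ↥SM) => Option.elim o (T (-1)) fun t => C (y t) * T (n t : ℤ)) :=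
        Algebra.subset_adjoin (Set.mem_range_self (some t))
      rcases le_or_gt N 0 with hNle | hNpos
      · -- `N ≤ 0`: `a t^N = (a t⁰) (t⁻¹)^k`
        obtain ⟨k, hk⟩ := Int.exists_eq_neg_ofNat hNle
        have hn0 : n t = 0 := Int.toNat_eq_zero.mpr hNle
        have e1 : AddMonoidAlgebra.single N (y t) = (C (y t) * T (n t : ℤ)) * T (-1) ^ k := by
          rw [hn0, Nat.cast_zero, T_zero, mul_one, T_pow, ← single_eq_C_mul_T,
            show (k : ℤ) * -1 = N by omega]
        rw [e1]
        exact Subalgebra.mul_mem _ htmem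
          (Subalgebra.pow_mem _ (Algebra.subset_adjoin (Set.mem_range_self none)) k)
      · have e1 : AddMonoidAlgebra.single N (y t) = C (y t) * T (n t : ℤ) := by
          rw [single_eq_C_mul_T, show (n t : ℤ) = N from Int.toNat_of_nonneg hNpos.le]
        rw [e1]
        exact htmem
    -- hence so does `x t^N`
    have hxmem : C x * T (N : ℤ) ∈ Algebra.adjoin A (Set.range fun o : Option (↥s × ↥SN × ↥SM) =>
        Option.elim o (T (-1)) fun t => C (y t) * T (n t : ℤ)) := by
      have h1 : C x * T (N : ℤ) ∈ F.extendedRees := F.C_mul_T_mem_extendedRees_iff.mpr hx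
      have h2 : C x * T (N : ℤ) ∈
          (Algebra.adjoin A (s : Set F.extendedRees)).map F.extendedRees.val := by
        rw [hs, Algebra.map_top, Subalgebra.range_val]
        exact h1
      rw [← Algebra.adjoin_image] at h2
      refine (Algebra.adjoin_le ?_) h2
      rintro _ ⟨p, hp, rfl⟩
      exact hgen p hp
    have h := coeff_mem_span_of_mem_adjoin y n hxmem N
    rwa [← single_eq_C_mul_T, coeff_single, Finsupp.single_eq_same] at h

end Rees

/-! ## The degree-zero parts are eventually generated in degree one -/

section Assembly

variable {C A M : Type} [CommRing C] [CommRing A] [Algebra C A] [DecidableEq M] [AddCommGroup M]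
  (𝒜 : M → AddSubgroup A) [GradedRing 𝒜]

/-- **The degree-`0` parts of a homogeneous filtration are eventually generated in degree one.**
Let `A` be a finitely generated `C`-algebra graded by the abelian group `M` with the scalars in
degree `0`, and `F = (Jₙ)` a descending multiplicative filtration of homogeneous ideals whose
extended Rees algebra `A[t⁻¹, Jₙ tⁿ]` is of finite type over `A`. Then there is `d > 0` such that
for every multiple `d'` of `d` and every `l`, every degree-`0` element of `J_{d'(l+1)}` is a sum of
products `u v` of degree-`0` elements `u ∈ J_{d'}`, `v ∈ J_{d'l}` — the Veronese subalgebra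
`⊕ₗ (J_{d'l})₀` of the invariant algebra `⊕ₙ (Jₙ)₀` is standard graded (finite generation of
invariants, Gordan/Dickson; eventually standard tails of a weighted polynomial ring, pigeonhole).
[folklore; Bourbaki, Alg. Comm. III §1 no. 3 Prop. 3; Mumford GIT Thm 1.1] -/
theorem veronese_degreeZero (h0 : ∀ c : C, algebraMap C A c ∈ 𝒜 0) (hA : Algebra.FiniteType C A)
    (F : IdealFiltration A) (hF : ∀ n, (F.ideal n).IsHomogeneous 𝒜)
    (hR : Algebra.FiniteType A F.extendedRees) :
    ∃ d : ℕ, 0 < d ∧ ∀ d' : ℕ, d ∣ d' → ∀ (l : ℕ) (x : A), x ∈ F.ideal (d' * (l + 1)) →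
      x ∈ 𝒜 0 →
      x ∈ AddSubgroup.closure {z : A | ∃ u v : A, u ∈ F.ideal d' ∧ u ∈ 𝒜 0 ∧
        v ∈ F.ideal (d' * l) ∧ v ∈ 𝒜 0 ∧ z = u * v} := by
  classical
  obtain ⟨ι, _, y, ny, δ, hy, hyδ, hyspan⟩ := exists_rees_generators 𝒜 F hF hR
  obtain ⟨ι', _, a, ε, hagen, ha⟩ := exists_homogeneous_adjoin_eq_top 𝒜 hA
  -- the combined homogeneous family: Rees generators and algebra generators (`t`-weight `0`)
  set z : ι ⊕ ι' → A := Sum.elim y a with hz_def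
  set e : ι ⊕ ι' → M := Sum.elim δ ε with he_def
  set n : ι ⊕ ι' → ℕ := Sum.elim ny (fun _ => 0) with hn_def
  have hz : ∀ k, z k ∈ F.ideal (n k) := by
    rintro (i | j)
    · exact hy i
    · change a j ∈ F.ideal 0
      rw [F.ideal_zero]
      exact Submodule.mem_top
  have hze : ∀ k, z k ∈ 𝒜 (e k) := by
    rintro (i | j)
    exacts [hyδ i, ha j]
  have hzgen : Algebra.adjoin C (Set.range z) = ⊤ := by
    rw [eq_top_iff, ← hagen]
    refine Algebra.adjoin_mono ?_
    rintro _ ⟨j, rfl⟩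
    exact ⟨Sum.inr j, rfl⟩
  have hzspan : ∀ (N : ℕ) (x : A), x ∈ F.ideal N →
      x ∈ Ideal.span {m | ∃ α : ι ⊕ ι' → ℕ, N ≤ ∑ k, α k * n k ∧ m = ∏ k, z k ^ α k} := by
    intro N x hx
    refine Ideal.span_mono ?_ (hyspan N x hx)
    rintro _ ⟨α, hα, rfl⟩
    refine ⟨Sum.elim α 0, ?_, ?_⟩
    · simpa only [Fintype.sum_sum_type, hz_def, hn_def, Sum.elim_inl, Sum.elim_inr, Pi.zero_apply,
        zero_mul, Finset.sum_const_zero, add_zero] using hα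
    · simp only [Fintype.prod_sum_type, hz_def, Sum.elim_inl, Sum.elim_inr, Pi.zero_apply, pow_zero,
        Finset.prod_const_one, mul_one]
  obtain ⟨σ, _, g, w, hg, hg0, hΦ⟩ :=
    exists_degreeZero_generators 𝒜 h0 F z e n hz hze hzgen hzspan
  -- `T N := C ⟨J_N ∩ A₀⟩ = J_N ∩ A₀`, a multiplicative antitone family of submodules
  have hTmem : ∀ (N : ℕ) (u : A),
      u ∈ Submodule.span C ((F.ideal N : Set A) ∩ (𝒜 0 : Set A)) ↔ u ∈ F.ideal N ∧ u ∈ 𝒜 0 := by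
    intro N u
    constructor
    · intro hu
      induction hu using Submodule.span_induction with
      | mem v hv => exact hv
      | zero => exact ⟨zero_mem _, zero_mem _⟩
      | add v v' _ _ hv hv' => exact ⟨add_mem hv.1 hv'.1, add_mem hv.2 hv'.2⟩
      | smul c v _ hv =>
        rw [Algebra.smul_def]
        exact ⟨Ideal.mul_mem_left _ _ hv.1,
          by simpa only [add_zero] using SetLike.mul_mem_graded (h0 c) hv.2⟩
    · exact fun hu => Submodule.subset_span hu
  haveI hT : SetLike.GradedMonoid
      (fun N : ℕ => Submodule.span C ((F.ideal N : Set A) ∩ (𝒜 0 : Set A))) :=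
    { one_mem := Submodule.subset_span
        ⟨by rw [SetLike.mem_coe, F.ideal_zero]; exact Submodule.mem_top, SetLike.one_mem_graded 𝒜⟩
      mul_mem := fun i j u v hu hv => by
        rw [hTmem] at hu hv
        rw [hTmem]
        exact ⟨F.mul_le i j (Ideal.mul_mem_mul hu.1 hv.1),
          by simpa only [add_zero] using SetLike.mul_mem_graded hu.2 hv.2⟩ }
  have hTanti : Antitone (fun N : ℕ => Submodule.span C ((F.ideal N : Set A) ∩ (𝒜 0 : Set A))) :=
    fun N N' h => Submodule.span_mono (Set.inter_subset_inter_left _ (F.antitone h))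
  have hgT : ∀ b, g b ∈
      (fun N : ℕ => Submodule.span C ((F.ideal N : Set A) ∩ (𝒜 0 : Set A))) (w b) :=
    fun b => Submodule.subset_span ⟨hg b, hg0 b⟩
  obtain ⟨d, hd, hV⟩ := exists_tail_veronese C w
  refine ⟨d, hd, fun d' hd' l x hx hx0 => ?_⟩
  rcases Nat.eq_zero_or_pos l with rfl | hl
  · rw [zero_add, mul_one] at hx
    refine AddSubgroup.subset_closure
      ⟨x, 1, hx, hx0, ?_, SetLike.one_mem_graded 𝒜, (mul_one x).symm⟩
    rw [mul_zero, F.ideal_zero]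
    exact Submodule.mem_top
  -- the target, an additive subgroup closed under the scalars
  let P : Submodule C A :=
    { carrier := AddSubgroup.closure {z : A | ∃ u v : A, u ∈ F.ideal d' ∧ u ∈ 𝒜 0 ∧
        v ∈ F.ideal (d' * l) ∧ v ∈ 𝒜 0 ∧ z = u * v}
      add_mem' := fun hu hv => AddSubgroup.add_mem _ hu hv
      zero_mem' := AddSubgroup.zero_mem _
      smul_mem' := fun c u hu => by
        refine AddSubgroup.closure_induction (p := fun u _ => c • u ∈ _) ?_ ?_ ?_ ?_ hu
        · rintro _ ⟨u, v, hu, hu0, hv, hv0, rfl⟩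
          refine AddSubgroup.subset_closure ⟨c • u, v, ?_, ?_, hv, hv0, (smul_mul_assoc c u v).symm⟩
          · rw [Algebra.smul_def]
            exact Ideal.mul_mem_left _ _ hu
          · rw [Algebra.smul_def]
            simpa only [add_zero] using SetLike.mul_mem_graded (h0 c) hu0
        · rw [smul_zero]
          exact AddSubgroup.zero_mem _
        · intro u v _ _ hu hv
          rw [smul_add]
          exact AddSubgroup.add_mem _ hu hv
        · intro u _ hu
          rw [smul_neg]
          exact AddSubgroup.neg_mem _ hu }
  change x ∈ P
  have hle : (fun N : ℕ => Submodule.span C ((F.ideal N : Set A) ∩ (𝒜 0 : Set A))) d' *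
      (fun N : ℕ => Submodule.span C ((F.ideal N : Set A) ∩ (𝒜 0 : Set A))) (d' * l) ≤ P := by
    rw [Submodule.mul_le]
    intro u hu v hv
    rw [hTmem] at hu hv
    exact AddSubgroup.subset_closure ⟨u, v, hu.1, hu.2, hv.1, hv.2, rfl⟩
  exact hle (iSup_map_le_mul _ g w hgT hTanti d' l (hV d' hd' l hl) (hΦ _ x hx hx0))

end Assembly

/-- **Sub-goal `stub_qs_degree_rees`** registered on the crux item for this helper file of stub
`stub_qs_degree`: the degree-`0` parts of a homogeneous filtration with finitely generated extended
Rees algebra are eventually generated in degree one (`veronese_degreeZero`). [folklore; Bourbaki,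
Alg. Comm. III §1 no. 3 Prop. 3; Mumford GIT Thm 1.1] -/
theorem stub_qs_degree_rees :
    ∀ {C A M : Type} [CommRing C] [CommRing A] [Algebra C A] [DecidableEq M] [AddCommGroup M]
      (𝒜 : M → AddSubgroup A) [GradedRing 𝒜], (∀ c : C, algebraMap C A c ∈ 𝒜 0) →
      Algebra.FiniteType C A →
      ∀ (F : Literature.AlgebraicGeometry.Resolution.IdealFiltration A),
      (∀ n, (F.ideal n).IsHomogeneous 𝒜) → Algebra.FiniteType A F.extendedRees →
      ∃ d : ℕ, 0 < d ∧ ∀ d' : ℕ, d ∣ d' → ∀ (l : ℕ) (x : A), x ∈ F.ideal (d' * (l + 1)) →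
        x ∈ 𝒜 0 → x ∈ AddSubgroup.closure {z : A | ∃ u v : A, u ∈ F.ideal d' ∧ u ∈ 𝒜 0 ∧
          v ∈ F.ideal (d' * l) ∧ v ∈ 𝒜 0 ∧ z = u * v} := by
  intro C A M _ _ _ _ _ 𝒜 _ h0 hA F hF hR
  exact veronese_degreeZero 𝒜 h0 hA F hF hR

end Summit.ResolutionOfSingularities.ResolutionOfSingularities.Theorems.DatumToEmbedded.Degree
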